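import Summits.BirchSwinnertonDyer.Rank1Residual.X12.CubeSumSylvesterOddPart
import Summits.BirchSwinnertonDyer.Rank1Residual.P2.CMRankOneAtTwoHeegnerIndex
import HarnessLib

/-!
# Class 𝒞_HSY (`x³ + y³ = p`, `p ≡ 4, 7 (mod 9)` prime, `3` not a cube mod `p`) AT THE PRIME `2`:
# full BSD(E_p) ⟺ ONE `L`-free `2`-adic Heegner-index valuation; and full BSD(E_p) from the typed
# O12 input `P2.CMRankOneHeegnerIndexAtTwo` (cell «bsd-cm», seat bsd-cm-two)

HONEST FRAMING (cell «bsd-cm», `run/shared/lean/pub/bsd-cm/`, D-0033 tranche 1a; verbatim in every file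
of the cell): the programme isolates, for CM elliptic curves over `ℚ` of analytic rank `≤ 1`, classes on
which the FULL Birch–Swinnerton-Dyer formula is reduced — strictly by PUBLISHED theorems entering as
named-fact binders — to ONE local problem at ONE prime, and then TYPES that residual problem. For 𝒞_HSY
the planner's REMARK-level assembly `X12/CubeSumSylvesterOddPart.lean` proved `BSD(E_p, ℓ)` at every ODD
`ℓ` and `(∀ ℓ, BSD(E_p, ℓ)) ⟺ BSD(E_p, 2)`; the residue `(E_p, 2)` is an O12 pair (CM by `ℤ[ζ₃]`, `2` inert,
GOOD SUPERSINGULAR at `2` with `a₂ = 0`, analytic rank `1`) — OPEN in print (Hu–Shu–Yin 2019 p. 3: "for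
`ℓ = 2, 3` … no results known"; Kobayashi 2013 Cor 1.4 is "up to `ℤ[1/2N]^×`"). This file composes that
assembly with the seat's O12 file `P2/CMRankOneAtTwoHeegnerIndex.lean`. NO new named fact, NO definition;
nothing asserted beyond the cited binders; nothing booked.

* `bsdp_two_iff_cmHeegnerIndex_of_model` — for every globally minimal `B ≅_ℚ E_p` and every auxiliary
  Heegner datum (`K′` imaginary quadratic with the Heegner hypothesis for a level `N` carrying a
  parametrisation datum of `B`, rank-zero twin, Heegner point `P`, minimal twist model `Wd`):
  FULL BSD(B) ⟺ `ord₂ 𝔮 = ord₂ #Ш(B)` with `𝔮 = cmHeegnerIndexQuotient …` — NO `L`-value, period or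
  height: the `2`-divisibility index of a Heegner point against `#Ш(B)`, `#Ш` and Tamagawa numbers of the
  CM rank-zero twin (Burungale–Flach 2024), torsion, Manin constant. (`r_an(B) = 1` is Hu–Shu–Yin Thm 1.3.)
* `forall_bsdp_of_heegnerIndexAtTwo` — granted the typed O12 input `P2.CMRankOneHeegnerIndexAtTwo` (and
  the named facts), FULL BSD(E_p) in Miller's prime-by-prime currency for the whole class 𝒞_HSY.
WHAT THIS IS NOT: not BSD(E_p, 2) for a single `p`; the typed input is OPEN and equivalent to the O12
corner (parent file's honesty clause). By Kezuka–Li 2020 Thm 1.3 (the `C_{2p}` family) one expects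
`Ш(E_p)[2] ≠ 0` for a positive proportion of 𝒞_HSY, so the identity is NOT a `2`-adic-unit statement
class-wide (the Li–Liu–Tian shape of the parent file's §4 applies only where `Ш(E_p)[2^∞] = 0`).

References: [HuShuYin2019] Thm. 1.3/1.4 and p. 3; [BurungaleFlach2024] Thm 1.1, Cor. 2, p. 6;
[KezukaLi2020] Thm. 1.3; [Kobayashi2013] Cor. 1.4; [Miller2011LMS] Def. 1.1; parents
`X12/CubeSumSylvesterOddPart.lean` (p396646), `P2/CMRankOneAtTwoHeegnerIndex.lean` (p396383).
-/

set_option autoImplicit false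

noncomputable section

open scoped Classical

open WeierstrassCurve NumberField Literature.NumberTheory.EllipticCurves
  Literature.NumberTheory.EllipticCurves.ModularForms
  Literature.NumberTheory.EllipticCurves.Rank1Residual
  Literature.NumberTheory.EllipticCurves.Rank1Residual.Typed
  Literature.NumberTheory.EllipticCurves.HuShuYin2019
  Summit.BirchSwinnertonDyer.Rank1Residual.P2

namespace Summit.BirchSwinnertonDyer.Rank1Residual.X12.Sylvester

variable {p : ℕ}

/-- **FULL BSD(E_p) ⟺ ONE `L`-FREE `2`-ADIC VALUATION** on 𝒞_HSY. For `p ≡ 4, 7 (mod 9)` prime with `3`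
not a cube mod `p`, `B` any globally minimal model of `E_p : x³ + y³ = p`, and any auxiliary datum as in
`P2.shaAn_eq_cmHeegnerIndexFormula_two` (`K′` imaginary quadratic, Heegner hypothesis for `N`,
parametrisation datum `Dt`, Heegner point `P ∈ B(K′)`, `L(B^{(d_{K′})},1) ≠ 0`, `Wd = Cd • B^{(d_{K′})}`
globally minimal): there is `k ∈ {1,2}` (the halvability value) with
`(∀ ℓ prime, BSD(B, ℓ)) ⟺ ord₂ (cmHeegnerIndexQuotient B K′ P c k Wd u) = ord₂ #Ш(B)`.
Ingredients: odd `ℓ` from the planner's assembly (`forall_bsdp_iff_bsdp_two`: HSY Thm 1.4 + BF24 at `3`,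
Li–Liu–Tian at `p`, Kobayashi elsewhere); `ℓ = 2` from `P2.bsdp_two_iff_cmHeegnerIndex` (Gross–Zagier,
Kolyvagin, GZK, modularity, BF24 for the twin); `r_an(B) = 1` and CM from the family facts.
[cite: HuShuYin2019, Thm. 1.3 and Thm. 1.4 (p. 3)] [cite: BurungaleFlach2024, Thm. 1.1 and Cor. 2]
[cite: Miller2011LMS, Def. 1.1] -/
theorem forall_bsdp_iff_cmHeegnerIndex_of_model (hHSY : thm14_threePart_product)
    (hCM0 : bsdTriple_of_hasCM_of_L_one_ne_zero) (hmod : hasEntireLFunction_rat)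
    (hLLT : LiLiuTian2024.thm11_bsdp_of_cm_rank_one)
    (hKob : Kobayashi2013.cor14_bsdp_of_cm_rank_one)
    (hGZK : rank_eq_analyticRank_of_analyticRank_le_one)
    (hp : p.Prime) (h9 : p % 9 = 4 ∨ p % 9 = 7) (h3 : ¬ ∃ x : ZMod p, x ^ 3 = 3)
    (B : WeierstrassCurve ℚ) [B.IsElliptic] [B.IsGloballyMinimal]
    (hB : ∃ C : VariableChange ℚ, C • B = cubeSumCurve (p : ℚ))
    (N : ℕ) [NeZero N] (K : Type) [Field K] [NumberField K]
    (Dt : ModularParametrizationData B N) (H : HeegnerDatum N (NumberField.discr K)) (ι : K →+* ℂ)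
    (P : (B.baseChange K).toAffine.Point)
    (hGZ : gross_zagier N B K) (hKo : kolyvagin N B K)
    (hK : IsImaginaryQuadratic K) (hHN : SatisfiesHeegnerHypothesis N K)
    (hP : WeierstrassCurve.Affine.Point.map ι.toRatAlgHom P = heegnerPointComplex Dt H)
    (hLt : (B.quadraticTwist (NumberField.discr K : ℚ)).entireLFunction 1 ≠ 0)
    (Wd : WeierstrassCurve ℚ) [Wd.IsElliptic] [Wd.IsGloballyMinimal] (Cd : VariableChange ℚ)
    (hWd : Cd • B.quadraticTwist (NumberField.discr K : ℚ) = Wd) :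
    ∃ k : ℕ, (k = 1 ∨ k = 2) ∧
      (k = 2 ↔ ∀ y : B.toAffine.Point, ∃ Q : (B.baseChange K).toAffine.Point,
        QuadraticDescent.incl K B y - (2 : ℤ) • Q ∈
          AddCommGroup.torsion (B.baseChange K).toAffine.Point) ∧
      ((∀ ℓ : ℕ, ℓ.Prime → BSDp B ℓ) ↔
        padicValRat 2 (cmHeegnerIndexQuotient B K P Dt.c k Wd Cd.u) = padicValNat 2 (Nat.card B.sha)) := by
  obtain ⟨hr, -, -⟩ := CubeSumFamilies.bsdp_three_of_thm14' hHSY hCM0 hmod hp h9 h3 B hB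
  obtain ⟨k, hk12, hkiff, hiff⟩ := bsdp_two_iff_cmHeegnerIndex B N K Dt H ι P hGZ hKo hGZK hmod hCM0
    (hasCM_of_model B hB) hK hHN hP hr hLt Wd Cd hWd
  exact ⟨k, hk12, hkiff,
    (forall_bsdp_iff_bsdp_two hHSY hCM0 hmod hLLT hKob hp h9 h3 B hB).trans hiff⟩

/-- **FULL BSD ON 𝒞_HSY FROM THE TYPED O12 INPUT.** Granted `P2.CMRankOneHeegnerIndexAtTwo` (the seat's
`L`-free `2`-adic Heegner-index input, OPEN) and the named facts (Hu–Shu–Yin 2019, Burungale–Flach 2024,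
modularity, Li–Liu–Tian 2024, Kobayashi 2013; Gross–Zagier, Kolyvagin, GZK, Waldspurger, parity, Heegner
points over `K`): for every prime `p ≡ 4, 7 (mod 9)` with `3` not a cube mod `p` and every globally minimal
`B ≅_ℚ E_p`, `BSD(B, ℓ)` at EVERY prime `ℓ`. Composition of `P2.cmCorner_of_heegnerIndexAtTwo` (⇒
`P2.CMNonsplitRankOneAtTwo`) with the planner's `forall_bsdp_of_cmNonsplitRankOneAtTwo`.
[cite: HuShuYin2019, Thm. 1.4 (p. 3)] [cite: BurungaleFlach2024, Thm. 1.1 and Cor. 2, p. 6] -/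
theorem forall_bsdp_of_heegnerIndexAtTwo (hHSY : thm14_threePart_product)
    (hCM0 : bsdTriple_of_hasCM_of_L_one_ne_zero) (hmod : hasEntireLFunction_rat)
    (hLLT : LiLiuTian2024.thm11_bsdp_of_cm_rank_one)
    (hKob : Kobayashi2013.cor14_bsdp_of_cm_rank_one)
    (hGZ : ∀ (N : ℕ) [NeZero N] (W : WeierstrassCurve ℚ) (K : Type) [Field K] [NumberField K],
      gross_zagier N W K)
    (hKo : ∀ (N : ℕ) [NeZero N] (W : WeierstrassCurve ℚ) (K : Type) [Field K] [NumberField K],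
      kolyvagin N W K)
    (hGZK : rank_eq_analyticRank_of_analyticRank_le_one)
    (hWa : waldspurger_exists_heegnerField_twist_ne_zero)
    (hpar : ∀ W : WeierstrassCurve ℚ, W.even_analyticRank_iff)
    (hHP : ∀ (W : WeierstrassCurve ℚ) (K : Type) [Field K] [NumberField K], exists_isHeegnerPoint W K)
    (hX : CMRankOneHeegnerIndexAtTwo)
    (hp : p.Prime) (h9 : p % 9 = 4 ∨ p % 9 = 7) (h3 : ¬ ∃ x : ZMod p, x ^ 3 = 3)
    (B : WeierstrassCurve ℚ) [B.IsElliptic] [B.IsGloballyMinimal]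
    (hB : ∃ C : VariableChange ℚ, C • B = cubeSumCurve (p : ℚ)) (ℓ : ℕ) (hℓ : ℓ.Prime) :
    BSDp B ℓ :=
  forall_bsdp_of_cmNonsplitRankOneAtTwo hHSY hCM0 hmod hLLT hKob
    (cmCorner_of_heegnerIndexAtTwo hGZ hKo hGZK hmod hCM0 hWa hpar hHP hX).1 hp h9 h3 B hB ℓ hℓ

/-- **The explicit models**: `BSD(sylvesterCurve p, ℓ)` (`y² + p y = x³ − 7p²`, the globally minimal model
of `E_p`) at EVERY prime `ℓ`, granted the typed O12 input and the named facts.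
[cite: HuShuYin2019, Thm. 1.4 (p. 3)] [cite: BurungaleFlach2024, p. 6] -/
theorem forall_bsdp_sylvesterCurve_of_heegnerIndexAtTwo (hHSY : thm14_threePart_product)
    (hCM0 : bsdTriple_of_hasCM_of_L_one_ne_zero) (hmod : hasEntireLFunction_rat)
    (hLLT : LiLiuTian2024.thm11_bsdp_of_cm_rank_one)
    (hKob : Kobayashi2013.cor14_bsdp_of_cm_rank_one)
    (hGZ : ∀ (N : ℕ) [NeZero N] (W : WeierstrassCurve ℚ) (K : Type) [Field K] [NumberField K],
      gross_zagier N W K)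
    (hKo : ∀ (N : ℕ) [NeZero N] (W : WeierstrassCurve ℚ) (K : Type) [Field K] [NumberField K],
      kolyvagin N W K)
    (hGZK : rank_eq_analyticRank_of_analyticRank_le_one)
    (hWa : waldspurger_exists_heegnerField_twist_ne_zero)
    (hpar : ∀ W : WeierstrassCurve ℚ, W.even_analyticRank_iff)
    (hHP : ∀ (W : WeierstrassCurve ℚ) (K : Type) [Field K] [NumberField K], exists_isHeegnerPoint W K)
    (hX : CMRankOneHeegnerIndexAtTwo)
    (hp : p.Prime) (h9 : p % 9 = 4 ∨ p % 9 = 7) (h3 : ¬ ∃ x : ZMod p, x ^ 3 = 3) (ℓ : ℕ) (hℓ : ℓ.Prime) :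
    haveI := isElliptic_sylvesterCurve hp.ne_zero
    haveI := isGloballyMinimal_sylvesterCurve hp (by omega)
    BSDp (sylvesterCurve p) ℓ := by
  haveI := isElliptic_sylvesterCurve hp.ne_zero
  haveI := isGloballyMinimal_sylvesterCurve hp (by omega)
  exact forall_bsdp_of_heegnerIndexAtTwo hHSY hCM0 hmod hLLT hKob hGZ hKo hGZK hWa hpar hHP hX hp h9 h3
    (sylvesterCurve p) (exists_smul_sylvesterCurve p) ℓ hℓ

end Summit.BirchSwinnertonDyer.Rank1Residual.X12.Sylvester

end
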